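import Mathlib
import Literature.Analysis.FluidPDE.VectorCalculus
import Literature.Analysis.Calculus.HadamardLemma
import Summits.NavierStokesRegularity.NavierStokesRegularity.Theorems.EulerZoomLiouvillePowerGaugeEulerLiouvilleSpacePeriodic
import HarnessLib

/-!
# FLAT SLICES VANISH: a field with a weak gradient annihilating a direction and sub-linear ball-energy growth is trivial
# (crux `EulerZoomLiouville.PowerGaugeEulerLiouville` = stmt-NavierStokesRegularity-19832; line `frozen-direction` of ns-idea-11 g2, stub F2
# `stub_flatSliceVanishes` — filler)

Route `EulerZoomLiouville` (NavierStokesRegularity); width seat ns-ezl-w1 (LEAD ns-typeII-p2 g10's width request 06:34:58Z, W-FD F2).  PACKING: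

* `FrozenDirection.translate_ae_eq_of_weakGradient_apply_eq_zero` — **weak `∂_e f = 0` ⇒ `f(· + s e) = f` a.e. for every `s`**: for a test
  function `g`, `ψ(x) = ∫₀ˢ g(x − t e) dt` is a test function (`contDiff_intervalIntegral`, compact support in a thickening of `tsupport g`)
  with `∂_e ψ = g − g(· − s e)` (FTC along the line), so the weak-gradient identity gives `∫ (g − g(· − s e)) • f = −∫ ψ • (G e) = 0`,
  i.e. `∫ g • f(· + s e) = ∫ g • f`, and `ae_eq_of_integral_contDiff_smul_eq` concludes (no parametric differentiation);
* `FrozenDirection.mul_sliceBall_le_of_ae` — a.e.-periodic twin of the lineage's packing lemma `SpacePeriodic.mul_sliceBall_le`;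
* `FrozenDirection.flatSlice_ae_eq_zero` = the line's `Sig.stub_flatSliceVanishes` VERBATIM: `HasWeakGradient f G`, `e ≠ 0`, `G x e = 0` a.e.,
  `∫_{B_r}‖f‖² ≤ K r^m` for `r > r₀` with `m < 1` ⇒ `f = 0` a.e. (pack `n` disjoint translates `B(k w, R)`, `w = s e`, `‖w‖ = 2R + |r₀| + 1`,
  inside `B(0, n‖w‖ + R)`: `n ∫_{B_R}‖f‖² ≤ K₊ ((‖w‖+R) n)^{m₊}`, so `∫_{B_R}‖f‖² ≲ n^{m₊−1} → 0`).

WHAT THIS IS NOT: not NS, not E — one M-sized stratum tool `--supports` stmt-19832 (F1 is the LEAD's; F3 open). [folklore]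
-/

noncomputable section

-- flat `Theorems/<Route><Decl>…` files of one crux share the namespace of the crux (tree convention: `Summit.<S>.<S>.…`)
set_option linter.dupNamespace false

open MeasureTheory Set Filter Topology Metric Function TopologicalSpace
open scoped ENNReal NNReal ContDiff

namespace Summit.NavierStokesRegularity.NavierStokesRegularity.Theorems.PowerGaugeEulerLiouville

open Literature.Analysis Literature.Analysis.FunctionSpaces Literature.Analysis.FluidPDE

namespace FrozenDirection

/-! ### Weak `∂_e f = 0` ⇒ translation invariance along `e` -/

/-- **A field whose weak gradient annihilates `e` is invariant under translations along `e`** (a.e., every `s`): `HasWeakGradient f G` and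
`G x e = 0` a.e. ⇒ `f(· + s e) = f` a.e.  Test `ψ(x) = ∫₀ˢ g(x − t e) dt`: `∂_e ψ = g − g(· − s e)`, so the weak identity gives
`∫ (g − g(· − s e)) • f = 0`, i.e. `∫ g • f(· + s e) = ∫ g • f` for every test `g`. [folklore] -/
theorem translate_ae_eq_of_weakGradient_apply_eq_zero
    {f : EuclideanSpace ℝ (Fin 3) → EuclideanSpace ℝ (Fin 3)}
    {G : EuclideanSpace ℝ (Fin 3) → EuclideanSpace ℝ (Fin 3) →L[ℝ] EuclideanSpace ℝ (Fin 3)}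
    (hfG : HasWeakGradient f G) (e : EuclideanSpace ℝ (Fin 3))
    (hGe : ∀ᵐ x ∂(volume : Measure (EuclideanSpace ℝ (Fin 3))), G x e = 0) (s : ℝ) :
    (fun y => f (y + s • e)) =ᵐ[volume] f := by
  have hf : LocallyIntegrable f volume := locallyIntegrableOn_univ.1 (by
    simpa only [Opens.coe_top] using hfG.locallyIntegrableOn)
  have hf' : LocallyIntegrable (fun y => f (y + s • e)) volume := by
    have hmap : Measure.map (⇑(Homeomorph.addRight (s • e))) (volume : Measure (EuclideanSpace ℝ (Fin 3))) = volume :=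
      (measurePreserving_add_right volume (s • e)).map_eq
    have h := (locallyIntegrable_map_homeomorph (Homeomorph.addRight (s • e)) (f := f)
      (μ := (volume : Measure (EuclideanSpace ℝ (Fin 3))))).1 (by rw [hmap]; exact hf)
    exact h
  refine ae_eq_of_integral_contDiff_smul_eq hf' hf fun g hg hgc => ?_
  -- ### the test function `ψ(x) = ∫₀ˢ g(x − t e) dt`
  have hgcont : Continuous g := hg.continuous
  have hgd : Differentiable ℝ g := hg.differentiable (by simp)
  set ψ : EuclideanSpace ℝ (Fin 3) → ℝ := fun x => ∫ t in (0 : ℝ)..s, g (x - t • e) with hψdef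
  -- smoothness
  have hF : ContDiff ℝ ∞ (uncurry fun (x : EuclideanSpace ℝ (Fin 3)) (t : ℝ) => g (x - t • e)) :=
    hg.comp (contDiff_fst.sub (contDiff_snd.smul contDiff_const))
  have hψs : ContDiff ℝ ∞ ψ := Literature.Analysis.Calculus.contDiff_intervalIntegral hF 0 s
  -- compact support: `ψ = 0` off the `|s|‖e‖`-thickening of `tsupport g`
  set Kc : Set (EuclideanSpace ℝ (Fin 3)) := cthickening (|s| * ‖e‖) (tsupport g) with hKc
  have hKc_cpt : IsCompact Kc := hgc.isCompact.cthickening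
  have hψc : HasCompactSupport ψ := by
    refine HasCompactSupport.intro hKc_cpt fun x hx => ?_
    have hzero : ∀ t ∈ uIcc (0 : ℝ) s, g (x - t • e) = 0 := by
      intro t ht
      by_contra hne
      have hmem : x - t • e ∈ tsupport g := subset_tsupport _ (Function.mem_support.2 hne)
      have hts : |t| ≤ |s| := by
        rcases mem_uIcc.1 ht with h | h
        · rw [abs_of_nonneg h.1, abs_of_nonneg (h.1.trans h.2)]; exact h.2
        · rw [abs_of_nonpos h.2, abs_of_nonpos (h.1.trans h.2)]; linarith [h.1]
      have hdist : dist x (x - t • e) ≤ |s| * ‖e‖ := by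
        rw [dist_eq_norm, sub_sub_cancel, norm_smul, Real.norm_eq_abs]
        exact mul_le_mul_of_nonneg_right hts (norm_nonneg _)
      exact hx (mem_cthickening_of_dist_le x (x - t • e) _ _ hmem hdist)
    rw [hψdef]
    simp only
    rw [intervalIntegral.integral_congr (g := fun _ => (0 : ℝ)) (fun t ht => hzero t ht)]
    simp
  have hψt : IsTestFunctionOn (⊤ : Opens (EuclideanSpace ℝ (Fin 3))) ψ := ⟨hψs, hψc, fun _ _ => trivial⟩
  -- ### directional derivative of `ψ` along `e`: `∂_e ψ (x) = g x − g (x − s e)`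
  have hDψ : ∀ x, fderiv ℝ ψ x e = g x - g (x - s • e) := by
    intro x
    set h : ℝ → ℝ := fun τ => g (x - τ • e) with hhdef
    have hhc : Continuous h := hgcont.comp (continuous_const.sub (continuous_id.smul continuous_const))
    -- the composition with the line through `x`
    have hline : HasDerivAt (fun r : ℝ => x + r • e) e 0 := by
      have := ((hasDerivAt_id (0 : ℝ)).smul_const e).const_add x
      simpa using this
    have h1 : HasDerivAt (fun r : ℝ => ψ (x + r • e)) (fderiv ℝ ψ x e) 0 := by
      have hd : HasFDerivAt ψ (fderiv ℝ ψ x) x := ((hψs.differentiable (by simp)) x).hasFDerivAt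
      exact hd.comp_hasDerivAt_of_eq (0 : ℝ) hline (by simp)
    -- the same function through the primitive of `h`
    have hfun : (fun r : ℝ => ψ (x + r • e)) =
        fun r => (∫ τ in (0 : ℝ)..(s - r), h τ) - ∫ τ in (0 : ℝ)..(0 - r), h τ := by
      funext r
      have e1 : ψ (x + r • e) = ∫ t in (0 : ℝ)..s, h (t - r) := by
        rw [hψdef]
        refine intervalIntegral.integral_congr fun t _ => ?_
        simp only [hhdef, sub_smul]
        congr 1
        abel
      rw [e1, intervalIntegral.integral_comp_sub_right h r,
        intervalIntegral.integral_interval_sub_left (hhc.intervalIntegrable _ _) (hhc.intervalIntegrable _ _)]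
    have h2 : HasDerivAt (fun r : ℝ => ψ (x + r • e)) (g x - g (x - s • e)) 0 := by
      rw [hfun]
      have hA : HasDerivAt (fun r : ℝ => ∫ τ in (0 : ℝ)..(s - r), h τ) ((-1 : ℝ) • h (s - 0)) 0 := by
        have hprim := (hhc.integral_hasStrictDerivAt 0 (s - 0)).hasDerivAt
        have hinner : HasDerivAt (fun r : ℝ => s - r) (-1 : ℝ) 0 := by
          simpa using (hasDerivAt_id (0 : ℝ)).const_sub s
        exact hprim.scomp (0 : ℝ) hinner
      have hB : HasDerivAt (fun r : ℝ => ∫ τ in (0 : ℝ)..(0 - r), h τ) ((-1 : ℝ) • h (0 - 0)) 0 := by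
        have hprim := (hhc.integral_hasStrictDerivAt 0 (0 - 0)).hasDerivAt
        have hinner : HasDerivAt (fun r : ℝ => 0 - r) (-1 : ℝ) 0 := by
          simpa using (hasDerivAt_id (0 : ℝ)).const_sub (0 : ℝ)
        exact hprim.scomp (0 : ℝ) hinner
      have hval : (-1 : ℝ) • h (s - 0) - (-1 : ℝ) • h (0 - 0) = g x - g (x - s • e) := by
        simp only [hhdef, sub_zero, zero_smul, smul_eq_mul]
        ring
      exact (hA.sub hB).congr_deriv hval
    exact h1.unique h2
  -- ### the weak identity with `ψ`: `∫ (g − g(· − s e)) • f = 0`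
  have hkey : ∫ x, (g x - g (x - s • e)) • f x = 0 := by
    have h := hfG.integral_fderiv_smul_eq ψ e hψt
    rw [Opens.coe_top, Measure.restrict_univ] at h
    have hR : ∫ x, ψ x • G x e = 0 := by
      rw [← integral_zero (EuclideanSpace ℝ (Fin 3)) (EuclideanSpace ℝ (Fin 3))]
      refine integral_congr_ae ?_
      filter_upwards [hGe] with x hx
      rw [hx, smul_zero]
    rw [hR, neg_zero] at h
    rw [← h]
    refine integral_congr_ae (Eventually.of_forall fun x => ?_)
    simp only [hDψ x]
  -- ### conclusion: `∫ g • f(· + s e) = ∫ g • f`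
  have hi1 : Integrable (fun x => g x • f x) := hf.integrable_smul_left_of_hasCompactSupport hgcont hgc
  have hgsc : HasCompactSupport (fun x => g (x - s • e)) := by
    have hfeq : (fun x => g (x - s • e)) = g ∘ (Homeomorph.addRight (-(s • e))) := by
      funext x
      simp [sub_eq_add_neg]
    rw [hfeq]
    exact hgc.comp_homeomorph _
  have hi2 : Integrable (fun x => g (x - s • e) • f x) :=
    hf.integrable_smul_left_of_hasCompactSupport (hgcont.comp (continuous_id.sub continuous_const)) hgsc
  have hshift : ∫ x, g x • f (x + s • e) = ∫ x, g (x - s • e) • f x := by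
    have := integral_add_right_eq_self (μ := (volume : Measure (EuclideanSpace ℝ (Fin 3))))
      (fun x => g (x - s • e) • f x) (s • e)
    simpa only [add_sub_cancel_right] using this
  rw [hshift]
  have hsplit : ∫ x, (g x - g (x - s • e)) • f x = (∫ x, g x • f x) - ∫ x, g (x - s • e) • f x := by
    simp_rw [sub_smul]
    exact integral_sub hi1 hi2
  rw [hsplit, sub_eq_zero] at hkey
  exact hkey.symm

/-! ### Packing a.e.-periodic translates -/

/-- **`n` disjoint a.e.-period-translates of `B(0,R)` carry `n` times its mass** (a.e. twin of `SpacePeriodic.mul_sliceBall_le`): if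
`g(· + k w) = g` a.e. for every `k : ℕ` and `‖w‖ ≥ 2R`, then `n · ∫_{B(0,R)} g ≤ ∫_{⋃_{k<n} B(k w, R)} g`. [folklore] -/
theorem mul_sliceBall_le_of_ae (g : EuclideanSpace ℝ (Fin 3) → ℝ≥0∞) {w : EuclideanSpace ℝ (Fin 3)} {R : ℝ}
    (hper : ∀ k : ℕ, (fun x => g (x + (k : ℝ) • w)) =ᵐ[volume] g) (hw : 2 * R ≤ ‖w‖) (n : ℕ) :
    (n : ℝ≥0∞) * ∫⁻ x in ball (0 : EuclideanSpace ℝ (Fin 3)) R, g x ≤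
      ∫⁻ x in ⋃ k ∈ Finset.range n, ball ((k : ℝ) • w) R, g x := by
  -- adapted from the tree's `SpacePeriodic.mul_sliceBall_le` (pointwise periodicity ↦ a.e.)
  have hmass : ∀ k : ℕ, ∫⁻ x in ball ((k : ℝ) • w) R, g x =
      ∫⁻ x in ball (0 : EuclideanSpace ℝ (Fin 3)) R, g x := by
    intro k
    rw [SpacePeriodic.setLIntegral_ball_translate]
    exact lintegral_congr_ae (ae_restrict_of_ae (hper k))
  induction n with
  | zero => simp
  | succ n ih =>
    have hdisj : Disjoint (⋃ k ∈ Finset.range n, ball ((k : ℝ) • w) R) (ball ((n : ℝ) • w) R) := by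
      refine disjoint_iUnion₂_left.2 fun k hk => ?_
      have hk' : (k : ℝ) + 1 ≤ n := by exact_mod_cast Finset.mem_range.1 hk
      refine ball_disjoint_ball ?_
      rw [dist_eq_norm, ← sub_smul, norm_smul, Real.norm_eq_abs, abs_sub_comm,
        abs_of_nonneg (by linarith)]
      nlinarith [norm_nonneg w]
    rw [Finset.range_add_one, Finset.set_biUnion_insert, union_comm,
      lintegral_union measurableSet_ball hdisj, hmass n]
    calc (((n + 1 : ℕ) : ℝ≥0∞)) * ∫⁻ x in ball (0 : EuclideanSpace ℝ (Fin 3)) R, g x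
        = (n : ℝ≥0∞) * (∫⁻ x in ball (0 : EuclideanSpace ℝ (Fin 3)) R, g x) +
            ∫⁻ x in ball (0 : EuclideanSpace ℝ (Fin 3)) R, g x := by
          push_cast; ring
      _ ≤ (∫⁻ x in ⋃ k ∈ Finset.range n, ball ((k : ℝ) • w) R, g x) +
            ∫⁻ x in ball (0 : EuclideanSpace ℝ (Fin 3)) R, g x := add_le_add ih le_rfl

/-! ### The flat slice vanishes -/

/-- **FLAT SLICES WITH SUB-LINEAR BALL-ENERGY GROWTH VANISH** (`Sig.stub_flatSliceVanishes` of the line `frozen-direction`, verbatim): a field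
`f : ℝ³ → ℝ³` with a weak gradient `G` such that `G x e = 0` a.e. for some `e ≠ 0`, and `∫_{B_r}‖f‖² ≤ K r^m` for all `r > max(r₀, 0)` with
`m < 1`, is `0` a.e.  Proof: `f` is a.e. invariant under every translation `s e` (previous lemma); with `w = s e`, `‖w‖ = 2R + |r₀| + 1`, pack
`n` disjoint translates of `B(0, R)` in `B(0, n‖w‖ + R)`: `n ∫_{B_R}‖f‖² ≤ max(K,0) ((‖w‖+R) n)^{max(m,0)}`, so
`∫_{B_R}‖f‖² ≤ C n^{max(m,0) − 1} → 0`; hence `f = 0` a.e. on every ball.  The exponent is sharp (`m = 1`: `(0,0,g(x₁,x₂))`, `g ∈ H¹(ℝ²)`).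
[folklore] -/
theorem flatSlice_ae_eq_zero (f : EuclideanSpace ℝ (Fin 3) → EuclideanSpace ℝ (Fin 3))
    (G : EuclideanSpace ℝ (Fin 3) → EuclideanSpace ℝ (Fin 3) →L[ℝ] EuclideanSpace ℝ (Fin 3))
    (hfG : HasWeakGradient f G) (e : EuclideanSpace ℝ (Fin 3)) (he : e ≠ 0)
    (hGe : ∀ᵐ x ∂(volume : Measure (EuclideanSpace ℝ (Fin 3))), G x e = 0)
    (K m r₀ : ℝ) (hm : m < 1)
    (hgrowth : ∀ r : ℝ, r₀ < r → 0 < r →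
      ∫⁻ x in ball (0 : EuclideanSpace ℝ (Fin 3)) r, ‖f x‖ₑ ^ 2 ≤ ENNReal.ofReal (K * r ^ m)) :
    f =ᵐ[volume] 0 := by
  have hf : LocallyIntegrable f volume := locallyIntegrableOn_univ.1 (by
    simpa only [Opens.coe_top] using hfG.locallyIntegrableOn)
  set g₂ : EuclideanSpace ℝ (Fin 3) → ℝ≥0∞ := fun x => ‖f x‖ₑ ^ 2 with hg₂
  -- ### a.e. invariance of `g₂` under every translate along `e`
  have hper : ∀ s : ℝ, (fun x => g₂ (x + s • e)) =ᵐ[volume] g₂ := fun s =>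
    (translate_ae_eq_of_weakGradient_apply_eq_zero hfG e hGe s).mono fun x hx => by
      simp only [hg₂, hx]
  -- ### every ball has zero energy
  have hball : ∀ R : ℝ, 0 < R → ∫⁻ x in ball (0 : EuclideanSpace ℝ (Fin 3)) R, g₂ x = 0 := by
    intro R hR
    set I : ℝ≥0∞ := ∫⁻ x in ball (0 : EuclideanSpace ℝ (Fin 3)) R, g₂ x with hI
    set ℓ : ℝ := 2 * R + |r₀| + 1 with hℓ
    have hℓ1 : 1 ≤ ℓ := by rw [hℓ]; linarith [abs_nonneg r₀]
    have hℓ0 : 0 < ℓ := by linarith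
    have he0 : 0 < ‖e‖ := norm_pos_iff.2 he
    set w : EuclideanSpace ℝ (Fin 3) := (ℓ / ‖e‖) • e with hw
    have hnw : ‖w‖ = ℓ := by
      rw [hw, norm_smul, Real.norm_of_nonneg (by positivity), div_mul_cancel₀ ℓ he0.ne']
    have hw2 : 2 * R ≤ ‖w‖ := by rw [hnw, hℓ]; linarith [abs_nonneg r₀]
    have hperk : ∀ k : ℕ, (fun x => g₂ (x + (k : ℝ) • w)) =ᵐ[volume] g₂ := by
      intro k
      have := hper ((k : ℝ) * (ℓ / ‖e‖))
      simpa only [hw, smul_smul] using this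
    -- exponents and constants
    set m' : ℝ := max m 0 with hm'
    have hm'0 : 0 ≤ m' := le_max_right _ _
    have hm'1 : m' < 1 := max_lt hm one_pos
    set K' : ℝ := max K 0 with hK'
    have hK'0 : 0 ≤ K' := le_max_right _ _
    set A : ℝ := K' * (ℓ + R) ^ m' with hA
    have hA0 : 0 ≤ A := by positivity
    -- the packing bound: `n I ≤ ofReal (A n^{m'})` for `n ≥ 1`
    have hpack : ∀ n : ℕ, 1 ≤ n → (n : ℝ≥0∞) * I ≤ ENNReal.ofReal (A * (n : ℝ) ^ m') := by
      intro n hn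
      have hn1 : (1 : ℝ) ≤ n := by exact_mod_cast hn
      set r : ℝ := (n : ℝ) * ‖w‖ + R with hr
      have hr1 : 1 ≤ r := by
        rw [hr, hnw]; nlinarith
      have hr0 : 0 < r := by linarith
      have hrr₀ : r₀ < r := by
        rw [hr, hnw]
        have : r₀ ≤ |r₀| := le_abs_self r₀
        nlinarith
      calc (n : ℝ≥0∞) * I ≤ ∫⁻ x in ⋃ k ∈ Finset.range n, ball ((k : ℝ) • w) R, g₂ x :=
            mul_sliceBall_le_of_ae g₂ hperk hw2 n
        _ ≤ ∫⁻ x in ball (0 : EuclideanSpace ℝ (Fin 3)) r, g₂ x :=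
            lintegral_mono_set (SpacePeriodic.iUnion_ball_subset n)
        _ ≤ ENNReal.ofReal (K * r ^ m) := hgrowth r hrr₀ hr0
        _ ≤ ENNReal.ofReal (A * (n : ℝ) ^ m') := by
            refine ENNReal.ofReal_le_ofReal ?_
            have h1 : K * r ^ m ≤ K' * r ^ m := mul_le_mul_of_nonneg_right (le_max_left _ _) (Real.rpow_nonneg hr0.le _)
            have h2 : r ^ m ≤ r ^ m' := Real.rpow_le_rpow_of_exponent_le hr1 (le_max_left _ _)
            have h3 : r ≤ (ℓ + R) * n := by rw [hr, hnw]; nlinarith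
            have h4 : r ^ m' ≤ ((ℓ + R) * n) ^ m' := Real.rpow_le_rpow hr0.le h3 hm'0
            have h5 : ((ℓ + R) * (n : ℝ)) ^ m' = (ℓ + R) ^ m' * (n : ℝ) ^ m' :=
              Real.mul_rpow (by positivity) (by positivity)
            calc K * r ^ m ≤ K' * r ^ m := h1
              _ ≤ K' * r ^ m' := mul_le_mul_of_nonneg_left h2 hK'0
              _ ≤ K' * ((ℓ + R) * n) ^ m' := mul_le_mul_of_nonneg_left h4 hK'0
              _ = A * (n : ℝ) ^ m' := by rw [h5, hA]; ring
    -- `I ≤ A n^{m' − 1} → 0`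
    refine le_antisymm (ENNReal.le_of_forall_pos_le_add fun δ hδ _ => ?_) zero_le
    rw [zero_add]
    have htend : Tendsto (fun x : ℝ => A * x ^ (m' - 1)) atTop (𝓝 (A * 0)) := by
      refine tendsto_const_nhds.mul ?_
      have := tendsto_rpow_neg_atTop (y := 1 - m') (by linarith)
      simpa [show -(1 - m') = m' - 1 by ring] using this
    rw [mul_zero] at htend
    have hδ' : (0 : ℝ) < δ := by exact_mod_cast hδ
    obtain ⟨x₀, hx₀⟩ := (htend.eventually (gt_mem_nhds hδ')).exists_forall_of_atTop
    obtain ⟨n, hn⟩ := exists_nat_ge (max x₀ 1)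
    have hn1 : 1 ≤ n := by exact_mod_cast (le_max_right x₀ 1).trans hn
    have hnx : x₀ ≤ (n : ℝ) := (le_max_left _ _).trans hn
    have hn0 : (0 : ℝ) < n := by exact_mod_cast hn1
    have hlt : A * (n : ℝ) ^ (m' - 1) < δ := hx₀ n hnx
    -- divide the packing bound by `n`
    have hdiv : I ≤ ENNReal.ofReal (A * (n : ℝ) ^ m') / (n : ℝ≥0∞) := by
      rw [ENNReal.le_div_iff_mul_le (Or.inl (Nat.cast_ne_zero.2 (Nat.one_le_iff_ne_zero.1 hn1)))
        (Or.inl (ENNReal.natCast_ne_top n)), mul_comm]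
      exact hpack n hn1
    calc I ≤ ENNReal.ofReal (A * (n : ℝ) ^ m') / (n : ℝ≥0∞) := hdiv
      _ = ENNReal.ofReal (A * (n : ℝ) ^ (m' - 1)) := by
          rw [← ENNReal.ofReal_natCast, ← ENNReal.ofReal_div_of_pos hn0]
          congr 1
          rw [Real.rpow_sub_one hn0.ne', mul_div_assoc]
      _ ≤ (δ : ℝ≥0∞) := by
          rw [← ENNReal.ofReal_coe_nnreal]; exact ENNReal.ofReal_le_ofReal hlt.le
  -- ### hence `f = 0` a.e.
  have hball_ae : ∀ n : ℕ, ∀ᵐ y ∂(volume.restrict (ball (0 : EuclideanSpace ℝ (Fin 3)) ((n : ℝ) + 1))), f y = 0 := by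
    intro n
    have h := hball ((n : ℝ) + 1) (by positivity)
    rw [lintegral_eq_zero_iff' (hf.aestronglyMeasurable.restrict.enorm.pow_const 2)] at h
    filter_upwards [h] with y hy
    simpa [hg₂] using hy
  have hunion : (⋃ n : ℕ, ball (0 : EuclideanSpace ℝ (Fin 3)) ((n : ℝ) + 1)) = univ := by
    refine eq_univ_of_forall fun y => mem_iUnion.2 ?_
    obtain ⟨n, hn⟩ := exists_nat_gt ‖y‖
    exact ⟨n, by rw [mem_ball, dist_zero_right]; linarith⟩
  have h := (ae_restrict_iUnion_iff (μ := (volume : Measure (EuclideanSpace ℝ (Fin 3))))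
    (fun n : ℕ => ball (0 : EuclideanSpace ℝ (Fin 3)) ((n : ℝ) + 1)) (fun y => f y = 0)).2 hball_ae
  rw [hunion, Measure.restrict_univ] at h
  exact h

end FrozenDirection

end Summit.NavierStokesRegularity.NavierStokesRegularity.Theorems.PowerGaugeEulerLiouville
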